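import Literature.NumberTheory.EllipticCurves.TateModuleTwistTransportProofs
import Literature.NumberTheory.EllipticCurves.InertiaInvariantsMultiplicativeProofs
import Literature.NumberTheory.EllipticCurves.QuadraticTwistJInvariantProofs
import Literature.NumberTheory.EllipticCurves.TateFormOfJ
import Literature.NumberTheory.DiophantineGeometry.LocalReductionHasMultiplicativeReductionAtProofs
import Literature.NumberTheory.DiophantineGeometry.LocalReductionIsIntegralAtProofs
import Literature.NumberTheory.DiophantineGeometry.LocalReductionProofs
import HarnessLib

/-!
# Potentially multiplicative reduction in every residue characteristic: a quadratic twist with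
# multiplicative reduction, and `V_ℓ E` is tame at the places `v ∤ 2ℓ` with `ord_v(j) < 0`

`Proofs` file (theorems only, no definitions, no named facts, no instances) in topic
`NumberTheory/EllipticCurves`, landed by the tenured seat of bsd.S15
(`Literature.NumberTheory.EllipticCurves.conductorNorm_eq_artinConductorNat`, `BSDConductor`) as
a bottom-up step in the printed proof architecture of Ogg's formula at the additive places of
residue characteristic `3` (Silverman, *ATAEC*, Thm. IV.11.1, case `p = 3`, PDF pp. 366–371:
the column `Iₙ*`, `n ≥ 1`, of the table on p. 368 — the potentially multiplicative additive
places — where `Type(E/M) = I₂ₙ` and `δ(E/K) = δ(E/M)/2 = 0`), and of Thm. IV.10.2(c) (the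
`ℓ`-independence of `f(E/K)`, cited out in the book, p. 362) at those places.

## Main results

* `WeierstrassCurve.hasMultiplicativeReductionAt_tateFormOfJ_of_one_lt_valuation_j` — over the
  fraction field `K` of any Dedekind domain `A`, at a finite place `v` with `ord_v(j(E)) < 0`
  (`1 < v.valuation K W.j`) the curve `y² + xy = x³ - 36x/(j - 1728) - 1/(j - 1728)` of
  invariant `j = j(E)` (`tateFormOfJ`, Silverman *AEC* III.1.4(c)) is `v`-integral with
  `ord_v(c₄) = 0` and `ord_v(Δ) = -ord_v(j) > 0`, hence has **multiplicative reduction at `v`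
  in every residue characteristic** (*AEC* VII.5.1(b); *ATAEC* V.5 Lemma 5.1: the Tate curve);
* `WeierstrassCurve.exists_hasMultiplicativeReductionAt_quadraticTwist_of_one_lt_valuation_j` —
  hence (characteristic `0`) **some quadratic twist `E^{(d)}` has multiplicative reduction at
  `v`**: `E` and `tateFormOfJ j(E)` have the same `j ≠ 0, 1728`, so they are quadratic twists of
  each other over `K` (*AEC* X.5.4, Cor. 5.4.1; `exists_variableChange_eq_quadraticTwist_of_j_eq'`).
  This removes the hypothesis `v ∤ 6` of `exists_hasMultiplicativeReductionAt_quadraticTwist`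
  (`QuadraticTwistMultiplicativeReductionProofs`, built on the short model, which is not
  `v`-integral for `v ∣ 6`): the statement now covers the wild residue characteristics `2, 3`;
* `WeierstrassCurve.isTameAt_rationalTate_of_one_lt_valuation_j` — for an elliptic curve over a
  number field, a prime `ℓ`, a place `v ∤ 2ℓ` (odd residue characteristic, **`3` allowed**) with
  `ord_v(j) < 0` and `𝔓 ∣ v`: **`V_ℓ E` is tamely ramified at `𝔓`**, unconditionally — the twist
  `E^{(d)}` has multiplicative reduction, so `I_𝔓` fixes a line of `V_ℓ E^{(d)}` (Thm. IV.10.2(a),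
  multiplicative case, the theorem `codimFixed_inertia_rationalTate_eq_one_of_hasMultiplicativeReductionAt_holds`),
  `I_𝔓 ∩ Γ_{K(√d)}` fixes a line of `V_ℓ E` (`codimFixed_inf_stabilizer_le_one_of_quadraticTwist`),
  `[K(√d) : K] ≤ 2` is prime to `p`, and unipotent inertia of determinant `1` is tame
  (`isTameAt_rationalTate_of_exists_fixed_of_det_eq_one_of_le`, `TateModuleTameDescentProofs`) —
  the printed proof of Thm. IV.10.2(b), case `v(j) < 0` (PDF pp. 359–360 and 362: *"`[K':K]` is
  not divisible by `p` … `L/K` is at worst tamely ramified"*), which for this case only uses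
  `p ≠ 2`;
* `WeierstrassCurve.swanConductorAt_rationalTate_eq_zero_of_one_lt_valuation_j`,
  `…codimFixed_absUpperRamificationSubgroup_rationalTate_eq_zero_of_one_lt_valuation_j`,
  `…swanConductorAt_rationalTate_eq_of_one_lt_valuation_j` — hence `Sw_𝔓(V_ℓ E) = 0`,
  `codim (V_ℓ E)^{Γ_K^u(𝔓)} = 0` for `u > 0`, and the `ℓ`-independence of `Sw_𝔓(V_ℓ E)`
  (Thm. IV.10.2(c)) at the potentially multiplicative places of odd residue characteristic; in
  particular at the additive places `v ∣ 3` with `ord_v(j) < 0` the Galois side of Ogg's formula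
  vanishes (`…_of_ringChar_eq_three_of_one_lt_valuation_j`), as the book's table (p. 368,
  column `Iₙ*`: `2f(E/K) - f(E/M) = 3 = 2ε(E/K) - ε(E/M)`, i.e. `δ(E/K) = 0`) asserts.

## References

* [SilvermanATAEC1994] J. H. Silverman, *Advanced Topics in the Arithmetic of Elliptic Curves*,
  GTM 151, Springer 1994: §IV.10, Thm. 10.2(a),(b),(c) and proof (PDF pp. 358–362); §IV.11,
  Thm. 11.1 and its proof for `p = 3` (PDF pp. 366–371, table p. 368); V.5 Lemma 5.1, Thm. 5.3.
* [SilvermanAEC2009] J. H. Silverman, *The Arithmetic of Elliptic Curves*, 2nd ed., GTM 106: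
  III.1 Prop. 1.4(b),(c) (the curve of invariant `j`), VII.5 Prop. 5.1(b), 5.5, X.5 Prop. 5.4 and
  Cor. 5.4.1 (quadratic twists for `j ≠ 0, 1728`).

## Design

Pure theorems; `noncomputable section`; universe `u` for the number field in §3; namespaces
`Literature.NumberTheory.EllipticCurves` (two identities on `tateFormOfJ`) and `WeierstrassCurve`
(dot-notation extensions next to `exists_hasMultiplicativeReductionAt_quadraticTwist` and
`swanConductorAt_rationalTate_eq_zero_of_codimFixed_quadraticTwist_le_one`).  §2 is stated over
the fraction field of an arbitrary Dedekind domain (`CharZero` only for the twist statement,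
the hypothesis of `exists_variableChange_eq_quadraticTwist_of_j_eq'`).  Axioms: `propext`,
`Classical.choice`, `Quot.sound`.
-/

noncomputable section

open scoped Classical NumberField
open Field IsDedekindDomain

universe u

/-! ## §1. `c₄` and `Δ` of the curve of invariant `j` -/

namespace Literature.NumberTheory.EllipticCurves

open WeierstrassCurve

variable {F : Type*} [Field F] {j : F}

/-- `c₄(tateFormOfJ j) = j/(j - 1728)` (from Mathlib's `ofJNe0Or1728_c₄ = j(j - 1728)³` and the
rescaling by `u = j - 1728`). Silverman, *AEC*, proof of Prop. III.1.4(c). [folklore] -/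
theorem tateFormOfJ_c₄ (h : j ≠ 1728) : (tateFormOfJ j).c₄ = j / (j - 1728) := by
  have h' : j - 1728 ≠ 0 := sub_ne_zero.mpr h
  rw [tateFormOfJ_eq_smul_ofJNe0Or1728 h, WeierstrassCurve.variableChange_c₄,
    WeierstrassCurve.ofJNe0Or1728_c₄]
  simp only [Units.val_inv_eq_inv_val, Units.val_mk0]
  field_simp

/-- `Δ(tateFormOfJ j) = j²/(j - 1728)³` (from Mathlib's `ofJNe0Or1728_Δ = j²(j - 1728)⁹`).
Silverman, *AEC*, proof of Prop. III.1.4(c). [folklore] -/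
theorem tateFormOfJ_Δ (h : j ≠ 1728) : (tateFormOfJ j).Δ = j ^ 2 / (j - 1728) ^ 3 := by
  have h' : j - 1728 ≠ 0 := sub_ne_zero.mpr h
  rw [tateFormOfJ_eq_smul_ofJNe0Or1728 h, WeierstrassCurve.variableChange_Δ,
    WeierstrassCurve.ofJNe0Or1728_Δ]
  simp only [Units.val_inv_eq_inv_val, Units.val_mk0]
  field_simp

end Literature.NumberTheory.EllipticCurves

namespace WeierstrassCurve

open Literature.NumberTheory.EllipticCurves Literature.NumberTheory.GaloisRepresentations
  IsDedekindDomain.HeightOneSpectrum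

/-! ## §2. Over the fraction field of a Dedekind domain: the Tate form of invariant `j(E)` has
multiplicative reduction where `ord_v(j) < 0`, and so does a quadratic twist of `E` -/

section Dedekind

variable {A : Type*} [CommRing A] [IsDedekindDomain A] {K : Type*} [Field K] [Algebra A K]
  [IsFractionRing A K] (v : HeightOneSpectrum A) (W : WeierstrassCurve K)

/-- At a place with `ord_v(j) < 0`: `j ≠ 0`, `j ≠ 1728` and `ord_v(j - 1728) = ord_v(j)`.
[folklore] -/
theorem j_ne_and_valuation_j_sub_eq_of_one_lt_valuation_j [W.IsElliptic]
    (hj : 1 < v.valuation K W.j) :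
    W.j ≠ 0 ∧ W.j ≠ 1728 ∧ v.valuation K (W.j - 1728) = v.valuation K W.j := by
  set ν := v.valuation K with hν
  have h1728 : ν (1728 : K) ≤ 1 := by
    rw [show (1728 : K) = algebraMap A K 1728 from (map_ofNat _ _).symm]
    exact v.valuation_le_one _
  have hlt : ν (1728 : K) < ν W.j := lt_of_le_of_lt h1728 hj
  have hsub : ν (W.j - 1728) = ν W.j := Valuation.map_sub_eq_of_lt_left ν hlt
  refine ⟨fun h ↦ ?_, fun h ↦ ?_, hsub⟩
  · rw [h, map_zero] at hj
    exact not_lt_zero hj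
  · rw [h] at hlt
    exact lt_irrefl _ hlt

/-- **The Tate form of invariant `j(E)` is `v`-integral where `ord_v(j) < 0`**: its coefficients
are `1, 0, 0, -36/(j - 1728), -1/(j - 1728)` and `ord_v(j - 1728) = ord_v(j) < 0`.
Silverman, *ATAEC*, V.5 Lemma 5.1; *AEC*, proof of Prop. VII.5.5.
[cite: SilvermanATAEC1994, V.5 Lemma 5.1] -/
theorem isIntegralAt_tateFormOfJ_of_one_lt_valuation_j [W.IsElliptic]
    (hj : 1 < v.valuation K W.j) : (tateFormOfJ W.j).IsIntegralAt v := by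
  set ν := v.valuation K with hν
  obtain ⟨-, -, hsub⟩ := W.j_ne_and_valuation_j_sub_eq_of_one_lt_valuation_j v hj
  have hpos : 0 < ν W.j := lt_trans zero_lt_one hj
  have h36 : ν (36 : K) ≤ 1 := by
    rw [show (36 : K) = algebraMap A K 36 from (map_ofNat _ _).symm]
    exact v.valuation_le_one _
  rw [isIntegralAt_iff_valuation_le_one]
  refine ⟨?_, ?_, ?_, ?_, ?_⟩
  · rw [tateFormOfJ_a₁, map_one]
  · rw [tateFormOfJ_a₂, map_zero]; exact zero_le_one
  · rw [tateFormOfJ_a₃, map_zero]; exact zero_le_one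
  · rw [tateFormOfJ_a₄, map_div₀, Valuation.map_neg, hsub, div_le_one₀ hpos]
    exact le_trans h36 (le_of_lt hj)
  · rw [tateFormOfJ_a₆, map_div₀, Valuation.map_neg, map_one, hsub, div_le_one₀ hpos]
    exact le_of_lt hj

/-- **`ord_v(c₄) = 0` and `ord_v(Δ) > 0` for the Tate form of invariant `j(E)` where
`ord_v(j) < 0`** (`c₄ = j/(j - 1728)`, `Δ = j²/(j - 1728)³`, `ord_v(j - 1728) = ord_v(j)`).
Silverman, *ATAEC*, V.5 Lemma 5.1. [cite: SilvermanATAEC1994, V.5 Lemma 5.1] -/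
theorem valuation_c₄_tateFormOfJ_eq_one_and_valuation_Δ_lt_one [W.IsElliptic]
    (hj : 1 < v.valuation K W.j) :
    v.valuation K (tateFormOfJ W.j).c₄ = 1 ∧ v.valuation K (tateFormOfJ W.j).Δ < 1 := by
  set ν := v.valuation K with hν
  obtain ⟨hj0, hj1728, hsub⟩ := W.j_ne_and_valuation_j_sub_eq_of_one_lt_valuation_j v hj
  have hpos : 0 < ν W.j := lt_trans zero_lt_one hj
  have hne : ν W.j ≠ 0 := ne_of_gt hpos
  refine ⟨?_, ?_⟩
  · rw [tateFormOfJ_c₄ hj1728, map_div₀, hsub, div_self hne]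
  · rw [tateFormOfJ_Δ hj1728, map_div₀, map_pow, map_pow, hsub,
      div_lt_one₀ (pow_pos hpos 3)]
    exact pow_lt_pow_right₀ hj (by norm_num)

/-- **The Tate form of invariant `j(E)` has multiplicative reduction at every place with
`ord_v(j(E)) < 0`, in every residue characteristic** (Silverman, *AEC*, Prop. VII.5.1(b) applied
to the `v`-integral equation `y² + xy = x³ - 36x/(j - 1728) - 1/(j - 1728)`, `ord_v(c₄) = 0`,
`ord_v(Δ) = -ord_v(j) > 0`: *ATAEC* V.5 Lemma 5.1 / the Tate curve `E_q` of Thm. V.5.3).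
[cite: SilvermanATAEC1994, V.5 Lemma 5.1 and Thm. V.5.3] [cite: SilvermanAEC2009, VII.5 Prop. 5.1(b)] -/
theorem hasMultiplicativeReductionAt_tateFormOfJ_of_one_lt_valuation_j [W.IsElliptic]
    (hj : 1 < v.valuation K W.j) : (tateFormOfJ W.j).HasMultiplicativeReductionAt v := by
  obtain ⟨hj0, hj1728, -⟩ := W.j_ne_and_valuation_j_sub_eq_of_one_lt_valuation_j v hj
  haveI := isElliptic_tateFormOfJ hj0 hj1728
  obtain ⟨hc₄, hΔ⟩ := W.valuation_c₄_tateFormOfJ_eq_one_and_valuation_Δ_lt_one v hj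
  exact hasMultiplicativeReductionAt_of_valuation_c₄_eq_one
    (W.isIntegralAt_tateFormOfJ_of_one_lt_valuation_j v hj) hc₄ hΔ

/-- **`E` is a quadratic twist of the Tate form of invariant `j(E)`** (characteristic `0`,
`j(E) ≠ 0, 1728`): `C • tateFormOfJ j(E) = E^{(d)}` for some `d ∈ K^*` and some change of
variables `C` over `K`. Silverman, *AEC*, X.5 Prop. 5.4 with Cor. 5.4.1; *ATAEC* V.5 Thm. 5.3
(`E` is isomorphic to `E_q` over `K(√γ)`). [cite: SilvermanAEC2009, X.5 Prop. 5.4 and Cor. 5.4.1] -/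
theorem exists_variableChange_tateFormOfJ_eq_quadraticTwist [CharZero K] [W.IsElliptic]
    (hj0 : W.j ≠ 0) (hj1728 : W.j ≠ 1728) :
    ∃ d : K, d ≠ 0 ∧ ∃ C : VariableChange K, C • tateFormOfJ W.j = W.quadraticTwist d := by
  haveI := isElliptic_tateFormOfJ hj0 hj1728
  have hjT : (tateFormOfJ W.j).j = W.j := tateFormOfJ_j hj0 hj1728
  exact exists_variableChange_eq_quadraticTwist_of_j_eq' hjT (by rw [hjT]; exact hj0)
    (by rw [hjT]; exact hj1728)

/-- **At a place with `ord_v(j) < 0` some quadratic twist has multiplicative reduction, in every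
residue characteristic** (Silverman, *ATAEC*, Thm. V.5.3 with Lemma V.5.2 in Tate-curve form; *AEC*
Prop. VII.5.5, VII.5.1(b) and X.5 Cor. 5.4.1).  For an elliptic curve `E/K`, `K` of
characteristic `0` the fraction field of a Dedekind domain, and a finite place `v` with
`ord_v(j(E)) < 0`, there is `d ∈ K^*` such that `E^{(d)} = W.quadraticTwist d` has multiplicative
reduction at `v`: `E^{(d)} = C • tateFormOfJ j(E)` for suitable `d`, `C`
(`exists_variableChange_tateFormOfJ_eq_quadraticTwist`), the Tate form has multiplicative
reduction at `v` (`hasMultiplicativeReductionAt_tateFormOfJ_of_one_lt_valuation_j`), and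
multiplicative reduction is invariant under `K`-isomorphism
(`hasMultiplicativeReductionAt_smul_iff_holds`).  Unlike
`exists_hasMultiplicativeReductionAt_quadraticTwist` no hypothesis `v ∤ 6` is needed.
[cite: SilvermanATAEC1994, V.5 Thm. 5.3 and Lemma 5.1]
[cite: SilvermanAEC2009, Prop. VII.5.5 with Prop. VII.5.1(b) and X.5 Cor. 5.4.1] -/
theorem exists_hasMultiplicativeReductionAt_quadraticTwist_of_one_lt_valuation_j [CharZero K]
    [W.IsElliptic] (hj : 1 < v.valuation K W.j) :
    ∃ d : K, d ≠ 0 ∧ (W.quadraticTwist d).HasMultiplicativeReductionAt v := by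
  obtain ⟨hj0, hj1728, -⟩ := W.j_ne_and_valuation_j_sub_eq_of_one_lt_valuation_j v hj
  haveI := isElliptic_tateFormOfJ hj0 hj1728
  obtain ⟨d, hd0, C, hC⟩ := W.exists_variableChange_tateFormOfJ_eq_quadraticTwist hj0 hj1728
  refine ⟨d, hd0, ?_⟩
  rw [← hC]
  exact (hasMultiplicativeReductionAt_smul_iff_holds v (tateFormOfJ W.j) C).mpr
    (W.hasMultiplicativeReductionAt_tateFormOfJ_of_one_lt_valuation_j v hj)

end Dedekind

/-! ## §3. Over a number field: `V_ℓ E` is tame at the places `v ∤ 2ℓ` with `ord_v(j) < 0` -/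

section NumberField

variable {K : Type u} [Field K] [NumberField K] (W : WeierstrassCurve K) (ℓ : ℕ) [Fact ℓ.Prime]

/-- **`V_ℓ E` is tamely ramified at a potentially multiplicative place of odd residue
characteristic** (Silverman *ATAEC* Thm. IV.10.2(b), proof, case `v(j) < 0`, PDF pp. 359–360
and 362, which for this case only uses `p ≠ 2`; unconditional here).  For an elliptic curve
`E/K` over a number field, a prime `ℓ`, a finite place `v ∤ ℓ` of residue characteristic
`p ≠ 2` (so `p = 3` is allowed) with `ord_v(j(E)) < 0`, and a prime `𝔓 ∣ v` of `\bar ℤ_K`: every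
wild ramification group `Γ_K^u(𝔓)`, `u > 0`, acts trivially on `V_ℓ E`.  Proof: a twist
`E^{(d)}` has multiplicative reduction at `v`
(`exists_hasMultiplicativeReductionAt_quadraticTwist_of_one_lt_valuation_j`), so
`codim (V_ℓ E^{(d)})^{I_𝔓} = 1` (Thm. IV.10.2(a), multiplicative case:
`codimFixed_inertia_rationalTate_eq_one_of_hasMultiplicativeReductionAt_holds`) and
`codim (V_ℓ E)^{I_𝔓 ∩ N} ≤ 1` for `N = Γ_{K(√d)}`
(`codimFixed_inf_stabilizer_le_one_of_quadraticTwist`); `N` is open, normal, of index `≤ 2`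
prime to `p` (`isOpen_stabilizer_geomSqrt`, `stabilizer_geomSqrt_normal`,
`not_dvd_index_stabilizer_geomSqrt`), so `Γ_K^u(𝔓) ≤ I_𝔓 ∩ N` for `u > 0`
(`absUpperRamificationSubgroup_le_inertia_inf_of_not_dvd_index`), and a subgroup of inertia
fixing a line with determinant `1` (`det_rationalTateRepresentation_eq_one_of_mem_inertia'`, Weil
pairing) acts tamely (`isTameAt_rationalTate_of_exists_fixed_of_det_eq_one_of_le`).
[cite: SilvermanATAEC1994, Thm. IV.10.2(b) and its proof, case v(j) < 0 (PDF pp. 358–362)] -/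
theorem isTameAt_rationalTate_of_one_lt_valuation_j [W.IsElliptic]
    (h : Continuous fun x : absoluteGaloisGroup K × RationalTateModule (geomPoints W) ℓ ↦
      rationalTateRepresentation (absoluteGaloisGroup K) (geomPoints W) ℓ x.1 x.2)
    {v : HeightOneSpectrum (𝓞 K)} (hℓ : (ℓ : 𝓞 K) ∉ v.asIdeal)
    (h2 : ringChar (𝓞 K ⧸ v.asIdeal) ≠ 2) (hj : 1 < v.valuation K W.j)
    {𝔓 : Ideal (absIntegers (𝓞 K) K)} (h𝔓 : 𝔓 ∈ v.primesAbove) :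
    (rationalTateGaloisRepOf (geomPoints W) ℓ h).IsTameAt (𝓞 K) 𝔓 := by
  obtain ⟨d, hd0, hmult⟩ :=
    W.exists_hasMultiplicativeReductionAt_quadraticTwist_of_one_lt_valuation_j v hj
  haveI : (W.quadraticTwist d).IsElliptic := W.isElliptic_quadraticTwist hd0
  haveI := stabilizer_geomSqrt_normal d (K := K)
  have hℓK : (ℓ : K) ≠ 0 := by exact_mod_cast (Fact.out : ℓ.Prime).ne_zero
  have hp : (ringChar (𝓞 K ⧸ v.asIdeal)).Prime := by
    haveI : Finite (𝓞 K ⧸ v.asIdeal) := Ideal.finiteQuotientOfFreeOfNeBot v.asIdeal v.ne_bot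
    exact CharP.char_is_prime (𝓞 K ⧸ v.asIdeal) _
  have h' := (W.quadraticTwist d).continuous_rationalGaloisRepTate_holds ℓ
  set N := MulAction.stabilizer (absoluteGaloisGroup K) (geomSqrt d) with hN
  have hcodim : (rationalTateGaloisRepOf (geomPoints W) ℓ h).codimFixed
      (𝔓.inertia (absoluteGaloisGroup K) ⊓ N) ≤ 1 :=
    W.codimFixed_inf_stabilizer_le_one_of_quadraticTwist ℓ hℓK h hd0 h'
      (𝔓.inertia (absoluteGaloisGroup K))
      (le_of_eq ((W.quadraticTwist d).codimFixed_inertia_rationalTate_eq_one_of_hasMultiplicativeReductionAt_holds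
        ℓ h' v hℓ hmult h𝔓))
  exact W.isTameAt_rationalTate_of_exists_fixed_of_det_eq_one_of_le ℓ h hℓ h𝔓
    (𝔓.inertia (absoluteGaloisGroup K) ⊓ N)
    (fun _ hu ↦ absUpperRamificationSubgroup_le_inertia_inf_of_not_dvd_index h𝔓 N
      (isOpen_stabilizer_geomSqrt d) (not_dvd_index_stabilizer_geomSqrt d hp h2) hu)
    (W.exists_ne_zero_fixed_of_codimFixed_le_one ℓ h _ hcodim)
    (fun _ hσ ↦ W.det_rationalTateRepresentation_eq_one_of_mem_inertia' ℓ hℓ h𝔓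
      (Subgroup.mem_inf.mp hσ).1)

/-- **`Sw_𝔓(V_ℓ E) = 0` at a potentially multiplicative place of odd residue characteristic**
(Silverman *ATAEC* Thm. IV.10.2(b), case `v(j) < 0`; unconditional, `p = 3` allowed): from
`isTameAt_rationalTate_of_one_lt_valuation_j` (`IsTameAt.swanConductorAt_eq_zero`).  This
removes the hypotheses `hTm` (now a theorem) and `p ≠ 3` of
`swanConductorAt_rationalTate_eq_zero_of_one_lt_valuation_j_of_codim`
(`HasseWeilAbelianTameNegativeJProofs`).
[cite: SilvermanATAEC1994, Thm. IV.10.2(b) and its proof, case v(j) < 0 (PDF pp. 358–362)] -/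
theorem swanConductorAt_rationalTate_eq_zero_of_one_lt_valuation_j [W.IsElliptic]
    (h : Continuous fun x : absoluteGaloisGroup K × RationalTateModule (geomPoints W) ℓ ↦
      rationalTateRepresentation (absoluteGaloisGroup K) (geomPoints W) ℓ x.1 x.2)
    {v : HeightOneSpectrum (𝓞 K)} (hℓ : (ℓ : 𝓞 K) ∉ v.asIdeal)
    (h2 : ringChar (𝓞 K ⧸ v.asIdeal) ≠ 2) (hj : 1 < v.valuation K W.j)
    {𝔓 : Ideal (absIntegers (𝓞 K) K)} (h𝔓 : 𝔓 ∈ v.primesAbove) :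
    (rationalTateGaloisRepOf (geomPoints W) ℓ h).swanConductorAt (𝓞 K) 𝔓 = 0 :=
  (W.isTameAt_rationalTate_of_one_lt_valuation_j ℓ h hℓ h2 hj h𝔓).swanConductorAt_eq_zero

/-- **`codim (V_ℓ E)^{Γ_K^u(𝔓)} = 0` for `u > 0`** at a potentially multiplicative place of odd
residue characteristic (pointwise form of the tameness
`isTameAt_rationalTate_of_one_lt_valuation_j`, `ContinuousRep.codimFixed_eq_zero_of_forall_eq_one`):
the integrand of the Swan conductor vanishes identically, for every `ℓ` with `v ∤ ℓ`.
[cite: SilvermanATAEC1994, Thm. IV.10.2(b),(c) and proof, case v(j) < 0 (PDF pp. 358–362)] -/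
theorem codimFixed_absUpperRamificationSubgroup_rationalTate_eq_zero_of_one_lt_valuation_j
    [W.IsElliptic]
    (h : Continuous fun x : absoluteGaloisGroup K × RationalTateModule (geomPoints W) ℓ ↦
      rationalTateRepresentation (absoluteGaloisGroup K) (geomPoints W) ℓ x.1 x.2)
    {v : HeightOneSpectrum (𝓞 K)} (hℓ : (ℓ : 𝓞 K) ∉ v.asIdeal)
    (h2 : ringChar (𝓞 K ⧸ v.asIdeal) ≠ 2) (hj : 1 < v.valuation K W.j)
    {𝔓 : Ideal (absIntegers (𝓞 K) K)} (h𝔓 : 𝔓 ∈ v.primesAbove) {t : ℝ} (ht : 0 < t) :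
    (rationalTateGaloisRepOf (geomPoints W) ℓ h).codimFixed
      (absUpperRamificationSubgroup (𝓞 K) 𝔓 t) = 0 :=
  ContinuousRep.codimFixed_eq_zero_of_forall_eq_one _
    ((W.isTameAt_rationalTate_of_one_lt_valuation_j ℓ h hℓ h2 hj h𝔓) t ht)

/-- **Thm. IV.10.2(c) at the potentially multiplicative places of odd residue characteristic**:
for two primes `ℓ, ℓ'` not below `v` (`p ≠ 2`, `ord_v(j) < 0`), `Sw_𝔓(V_ℓ E) = Sw_𝔓(V_{ℓ'} E)`
(both vanish).  Silverman, *ATAEC*, Thm. IV.10.2(c) ("`f(E/K)` is independent of `ℓ`", cited out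
in the book, PDF p. 362), here proved for this class of places.
[cite: SilvermanATAEC1994, Thm. IV.10.2(c) (PDF pp. 358, 362)] -/
theorem swanConductorAt_rationalTate_eq_of_one_lt_valuation_j [W.IsElliptic]
    (h : Continuous fun x : absoluteGaloisGroup K × RationalTateModule (geomPoints W) ℓ ↦
      rationalTateRepresentation (absoluteGaloisGroup K) (geomPoints W) ℓ x.1 x.2)
    (ℓ' : ℕ) [Fact ℓ'.Prime]
    (h' : Continuous fun x : absoluteGaloisGroup K × RationalTateModule (geomPoints W) ℓ' ↦
      rationalTateRepresentation (absoluteGaloisGroup K) (geomPoints W) ℓ' x.1 x.2)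
    {v : HeightOneSpectrum (𝓞 K)} (hℓ : (ℓ : 𝓞 K) ∉ v.asIdeal) (hℓ' : (ℓ' : 𝓞 K) ∉ v.asIdeal)
    (h2 : ringChar (𝓞 K ⧸ v.asIdeal) ≠ 2) (hj : 1 < v.valuation K W.j)
    {𝔓 : Ideal (absIntegers (𝓞 K) K)} (h𝔓 : 𝔓 ∈ v.primesAbove) :
    (rationalTateGaloisRepOf (geomPoints W) ℓ h).swanConductorAt (𝓞 K) 𝔓 =
      (rationalTateGaloisRepOf (geomPoints W) ℓ' h').swanConductorAt (𝓞 K) 𝔓 := by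
  rw [W.swanConductorAt_rationalTate_eq_zero_of_one_lt_valuation_j ℓ h hℓ h2 hj h𝔓,
    W.swanConductorAt_rationalTate_eq_zero_of_one_lt_valuation_j ℓ' h' hℓ' h2 hj h𝔓]

/-- **The Galois side of Ogg's formula vanishes at the additive places `v ∣ 3` with
`ord_v(j) < 0`** (the column `Iₙ*`, `n ≥ 1`, of the table in the proof of Silverman *ATAEC*
Thm. IV.11.1 for `p = 3`, PDF p. 368: these are the additive places of residue characteristic `3`
with potentially multiplicative reduction, and there `δ(E/K) = δ(E/M)/2 = 0`): for a prime `ℓ`,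
a place `v ∤ ℓ` with `ringChar (𝓞 K ⧸ v) = 3` and `ord_v(j(E)) < 0`, and `𝔓 ∣ v`,
`Sw_𝔓(V_ℓ E) = 0` — the specialisation `p = 3 ≠ 2` of
`swanConductorAt_rationalTate_eq_zero_of_one_lt_valuation_j`.
[cite: SilvermanATAEC1994, proof of Thm. IV.11.1, case p = 3, table p. 368 (PDF pp. 366–369)] -/
theorem swanConductorAt_rationalTate_eq_zero_of_ringChar_eq_three_of_one_lt_valuation_j
    [W.IsElliptic]
    (h : Continuous fun x : absoluteGaloisGroup K × RationalTateModule (geomPoints W) ℓ ↦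
      rationalTateRepresentation (absoluteGaloisGroup K) (geomPoints W) ℓ x.1 x.2)
    {v : HeightOneSpectrum (𝓞 K)} (hℓ : (ℓ : 𝓞 K) ∉ v.asIdeal)
    (h3 : ringChar (𝓞 K ⧸ v.asIdeal) = 3) (hj : 1 < v.valuation K W.j)
    {𝔓 : Ideal (absIntegers (𝓞 K) K)} (h𝔓 : 𝔓 ∈ v.primesAbove) :
    (rationalTateGaloisRepOf (geomPoints W) ℓ h).swanConductorAt (𝓞 K) 𝔓 = 0 :=
  W.swanConductorAt_rationalTate_eq_zero_of_one_lt_valuation_j ℓ h hℓ (by rw [h3]; decide) hj h𝔓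

end NumberField

end WeierstrassCurve

end
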